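import Literature.Analysis.FluidPDE.ForwardDSSLocalLeray
import Literature.Analysis.FluidPDE.AxisymmetricEuler
import HarnessLib

/-!
# Forward discretely self-similar solutions, part I: Tsai, Comm. Math. Phys. 328 (2014) =
  arXiv:1210.2783, Theorems 1.1 and 1.2

Analysis/FluidPDE named-fact file (cell `pub-ns-dss`, lit seat, LIT-COVERAGE gap G2). The tree vendors the
forward `λ`-DSS existence theorems of Bradshaw–Tsai 2017 [BT1] (`bradshawTsai2017_dss_localLeray_existence`,
any `λ > 1`, `L³_w` data), Chae–Wolf 2018 and Bradshaw–Tsai 2019 (`L²_loc` data) and, with rotation,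
Bradshaw–Tsai CPDE 2017 (`ForwardRDSSExistence.lean`); the FIRST forward-DSS existence theorem — T.-P. Tsai,
*Forward discretely self-similar solutions of the Navier–Stokes equations*, CMP 328 (2014) 29–44 — was cited
(`[cite: Tsai2014]` on `IsDiscretelySelfSimilar`) but not stated. It is the only printed forward statement
carrying the POINTWISE scale-critical envelope `|u(x,t)| ≤ C/(|x| + √t)` (the forward mirror of the tree's
`HasTypeIDecay`) together with `|u − e^{tΔ}u₀| ≤ C√t/(|x|² + t)`, for large Hölder data — at the price of a
factor `λ` close to `1` (Thm 1.1), or of axisymmetry without swirl (Thm 1.2, any `λ`). Held text: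
`paper:arxiv-1210.2783` (pages `p.` below).

## What is printed (§1, pp. 2–4)

* Local-Leray solutions (p. 2 (1.9)–(1.11), p. 3 (i)–(iv)): `u₀ ∈ L²_loc`, `‖u₀‖_{L²_uloc} < ∞`, `div u₀ = 0`;
  `u ∈ L²_loc(ℝ³ × [0,∞))` with (i) the uniformly local energy bounds (1.10) and the decay (1.11), (ii) a
  distribution `p` with which (1.1) holds in `ℝ⁴₊` in the sense of distributions, (iii)
  `lim_{t→0⁺} ‖u(·,t) − u₀‖_{L²(K)} = 0` for compact `K`, (iv) suitability in the sense of CKN — i.e. the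
  Lemarié-Rieusset / Jia–Šverák class, the tree's `IsLocalLeraySolution` (Kang–Miura–Tsai Def. 3.2; the same
  identification as for [BT1] Def. 1.1 in `ForwardDSSExistence.lean`).
* **Theorem 1.1** (p. 3 L16–30, "Existence of DSS solutions with factor close to one"): "For any `0 < γ < 1`
  and `C_* > 0`, there is `λ_* = λ_*(γ, C_*) ∈ (1, 2)` such that the following hold. Suppose
  `u₀ ∈ C^γ_loc(ℝ³∖{0})`, `‖u₀‖_{C^γ(B̄₂∖B₁)} ≤ C_*`, `div u₀ = 0`, and `u₀` is DSS with factor `λ ∈ (1, λ_*]`.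
  Then there is a local-Leray solution `u` of (1.1) with initial data `u₀` that is DSS with factor `λ` and,
  for `v(·,t) := u(·,t) − e^{tΔ}u₀`, `|u(x,t)| ≤ C/(|x| + √t)`, `|v(x,t)| ≤ C√t/(|x|² + t)` (1.12) in `ℝ⁴₊`
  with `C = C(γ, C_*)`. It is also a mild solution in the class (1.12)₁. [If furthermore
  `‖u₀‖_{C^{1,β}(B̄₂∖B₁)} ≤ C_*` … (1.13).]" "Note that `λ − 1 > 0` has to be small enough." (p. 3 L50)
* **Theorem 1.2** (p. 3 L76 – p. 4 L3, "Existence of axisymmetric DSS solutions with no swirl"): "For any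
  `1 < λ < ∞`, `0 < γ < 1`, and `C_* > 0`, suppose `u₀ ∈ C^γ_loc(ℝ³∖{0})`, is axisymmetric with no swirl, DSS
  with factor `λ`, `div u₀ = 0`, and `‖u₀‖_{C^γ(B̄_λ∖B₁)} ≤ C_*`. Then there is a local-Leray solution `u` of
  (1.1) with initial data `u₀` that is DSS with factor `λ`, axisymmetric with no swirl, and satisfies (1.12) in
  `ℝ⁴₊` with `C = C(λ, γ, C_*)`. It is also a mild solution in the class (1.12)₁."

## Rendering

* `u₀ ∈ C^γ_loc(ℝ³∖{0})`: `HolderOnWith` on every compact `K ⊆ ℝ³∖{0}`; the annulus norm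
  `‖u₀‖_{C^γ(Ā)} = ‖u₀‖_{L^∞(Ā)} + [u₀]_{γ,Ā} ≤ C_*` is rendered as the two bounds `‖u₀ x‖ ≤ C_*` on `Ā` and
  `HolderOnWith C_* γ u₀ Ā` (each `≤ C_*`; this reparametrises `C_*` by at most a factor `2`, immaterial in a
  `∀ C_*, ∃ λ_*` statement); `div u₀ = 0` for Hölder data is the weak `IsWeaklyDivFree`; DSS data/solutions are
  the tree's `nsRescaleData λ u₀ = u₀` / `IsDiscretelySelfSimilar λ u` (imposed at all times; extension by `0`
  to `t ≤ 0`, which no clause of `IsLocalLeraySolution` sees); `e^{tΔ}u₀` is `UnboundedOperators.heatExtension`.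
* The bounds (1.12) are stated for all `t > 0`, `x` (the local-Leray solution is taken to be the continuous
  representative the paper constructs as a mild solution); `C` is quantified BEFORE the datum ("`C = C(γ, C_*)`",
  resp. `C(λ, γ, C_*)`). Omitted (weakening of the conclusion): "It is also a mild solution in the class
  (1.12)₁" and the `C^{1,β}` refinement (1.13).
* Viscosity `1` (the paper's (1.1)).

## References

* T.-P. Tsai, *Forward discretely self-similar solutions of the Navier–Stokes equations*, Comm. Math. Phys. 328
  (2014) 29–44 = arXiv:1210.2783, §1: (1.9)–(1.13), Theorems 1.1–1.2 (pp. 2–4). [Tsai2014] (bib key is the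
  interim stub of that paper; doi:10.1007/s00220-014-1984-3)
* Z. Bradshaw, T.-P. Tsai, Ann. Henri Poincaré 18 (2017) [BT1], Def. 1.1 (local Leray solutions).
  [BradshawTsai2017AHP]
* K. Kang, H. Miura, T.-P. Tsai, IMRN 2021, Def. 3.2 (`IsLocalLeraySolution`). [KangMiuraTsai2020]
-/

noncomputable section

open MeasureTheory Set Function Filter Topology TopologicalSpace Metric
open scoped NNReal ENNReal

namespace Literature.Analysis.FluidPDE

/-- Local notation for physical space `ℝ³ = EuclideanSpace ℝ (Fin 3)`. -/
local notation "ℝ³" => EuclideanSpace ℝ (Fin 3)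

/-- **Tsai 2014, Theorem 1.1 (existence of forward `λ`-DSS local-Leray solutions with factor close to one,
with the scale-critical pointwise envelope).** For any `0 < γ < 1` and `C_* > 0` there are `λ_* ∈ (1, 2)` and
`C` (depending only on `γ`, `C_*`) such that: if `u₀ : ℝ³ → ℝ³` is locally `γ`-Hölder on `ℝ³ ∖ {0}`, with
`‖u₀‖ ≤ C_*` and Hölder constant `≤ C_*` on the closed annulus `1 ≤ ‖x‖ ≤ 2`, weakly divergence free, and
`λ`-DSS (`λ u₀(λx) = u₀(x)`) for some `λ ∈ (1, λ_*]`, then there is a local-Leray solution `(u, p)` (ν = 1) with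
initial data `u₀` (`IsLocalLeraySolution 1 u₀ u p`) which is `λ`-DSS and satisfies, for all `t > 0` and `x`,
`‖u(t,x)‖ ≤ C/(‖x‖ + √t)` and `‖u(t,x) − e^{tΔ}u₀(x)‖ ≤ C√t/(‖x‖² + t)` (1.12). (Print adds: `u` is also a
mild solution in the class (1.12)₁ — omitted.) [cite: Tsai2014, Theorem 1.1 (arXiv:1210.2783 p. 3)] -/
def tsai2014_dss_existence_nearOne : Prop :=
  ∀ (γ : ℝ≥0) (Cstar : ℝ≥0), 0 < γ → γ < 1 → 0 < Cstar →
    ∃ cstar C : ℝ, 1 < cstar ∧ cstar < 2 ∧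
      ∀ (c : ℝ) (u₀ : ℝ³ → ℝ³), 1 < c → c ≤ cstar →
        (∀ K : Set ℝ³, IsCompact K → (0 : ℝ³) ∉ K → ∃ C' : ℝ≥0, HolderOnWith C' γ u₀ K) →
        (∀ x : ℝ³, 1 ≤ ‖x‖ → ‖x‖ ≤ 2 → ‖u₀ x‖ ≤ Cstar) →
        HolderOnWith Cstar γ u₀ {x : ℝ³ | 1 ≤ ‖x‖ ∧ ‖x‖ ≤ 2} →
        IsWeaklyDivFree u₀ → FluidPDE.nsRescaleData c u₀ = u₀ →
        ∃ (u : ℝ → ℝ³ → ℝ³) (p : ℝ → ℝ³ → ℝ),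
          IsLocalLeraySolution 1 u₀ u p ∧ FluidPDE.IsDiscretelySelfSimilar c u ∧
          (∀ t : ℝ, 0 < t → ∀ x : ℝ³, ‖u t x‖ ≤ C / (‖x‖ + Real.sqrt t)) ∧
          (∀ t : ℝ, 0 < t → ∀ x : ℝ³,
            ‖u t x - UnboundedOperators.heatExtension u₀ t x‖ ≤ C * Real.sqrt t / (‖x‖ ^ 2 + t))

/-- **Tsai 2014, Theorem 1.2 (existence of forward axisymmetric no-swirl `λ`-DSS local-Leray solutions, any
factor).** For any `1 < λ < ∞`, `0 < γ < 1` and `C_* > 0` there is `C = C(λ, γ, C_*)` such that: if `u₀` is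
locally `γ`-Hölder on `ℝ³ ∖ {0}`, axisymmetric (`IsAxisymmetric`) with no swirl (`HasNoSwirl`), `λ`-DSS, weakly
divergence free, with `‖u₀‖ ≤ C_*` and Hölder constant `≤ C_*` on the closed annulus `1 ≤ ‖x‖ ≤ λ`, then there
is a local-Leray solution `(u, p)` with initial data `u₀`, `λ`-DSS, axisymmetric with no swirl at every `t > 0`,
obeying (1.12) with `C` for all `t > 0`, `x`. (Mild-solution clause omitted as in Thm 1.1.) [cite: Tsai2014, Theorem 1.2 (arXiv:1210.2783 pp. 3–4)] -/
def tsai2014_dss_existence_axisymNoSwirl : Prop :=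
  ∀ (c : ℝ) (γ : ℝ≥0) (Cstar : ℝ≥0), 1 < c → 0 < γ → γ < 1 → 0 < Cstar →
    ∃ C : ℝ, ∀ (u₀ : ℝ³ → ℝ³),
      (∀ K : Set ℝ³, IsCompact K → (0 : ℝ³) ∉ K → ∃ C' : ℝ≥0, HolderOnWith C' γ u₀ K) →
      IsAxisymmetric u₀ → HasNoSwirl u₀ →
      (∀ x : ℝ³, 1 ≤ ‖x‖ → ‖x‖ ≤ c → ‖u₀ x‖ ≤ Cstar) →
      HolderOnWith Cstar γ u₀ {x : ℝ³ | 1 ≤ ‖x‖ ∧ ‖x‖ ≤ c} →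
      IsWeaklyDivFree u₀ → FluidPDE.nsRescaleData c u₀ = u₀ →
      ∃ (u : ℝ → ℝ³ → ℝ³) (p : ℝ → ℝ³ → ℝ),
        IsLocalLeraySolution 1 u₀ u p ∧ FluidPDE.IsDiscretelySelfSimilar c u ∧
        (∀ t : ℝ, 0 < t → IsAxisymmetric (u t) ∧ HasNoSwirl (u t)) ∧
        (∀ t : ℝ, 0 < t → ∀ x : ℝ³, ‖u t x‖ ≤ C / (‖x‖ + Real.sqrt t)) ∧
        (∀ t : ℝ, 0 < t → ∀ x : ℝ³,
          ‖u t x - UnboundedOperators.heatExtension u₀ t x‖ ≤ C * Real.sqrt t / (‖x‖ ^ 2 + t))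

/-! ### Consequences (bookkeeping) -/

/-- Under Theorem 1.1 the envelope constant may be taken positive: the bound `‖u‖ ≤ C/(‖x‖+√t)` at any
point forces `0 ≤ C`, and `C` may be enlarged. (Bookkeeping for consumers who divide by `C`.) [cite: Tsai2014, Theorem 1.1 (arXiv:1210.2783 p. 3)] -/
theorem tsai2014_dss_existence_nearOne.exists_pos (h : tsai2014_dss_existence_nearOne) {γ Cstar : ℝ≥0}
    (hγ : 0 < γ) (hγ1 : γ < 1) (hC : 0 < Cstar) :
    ∃ cstar C : ℝ, 1 < cstar ∧ cstar < 2 ∧ 0 < C ∧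
      ∀ (c : ℝ) (u₀ : ℝ³ → ℝ³), 1 < c → c ≤ cstar →
        (∀ K : Set ℝ³, IsCompact K → (0 : ℝ³) ∉ K → ∃ C' : ℝ≥0, HolderOnWith C' γ u₀ K) →
        (∀ x : ℝ³, 1 ≤ ‖x‖ → ‖x‖ ≤ 2 → ‖u₀ x‖ ≤ Cstar) →
        HolderOnWith Cstar γ u₀ {x : ℝ³ | 1 ≤ ‖x‖ ∧ ‖x‖ ≤ 2} →
        IsWeaklyDivFree u₀ → FluidPDE.nsRescaleData c u₀ = u₀ →
        ∃ (u : ℝ → ℝ³ → ℝ³) (p : ℝ → ℝ³ → ℝ),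
          IsLocalLeraySolution 1 u₀ u p ∧ FluidPDE.IsDiscretelySelfSimilar c u ∧
          (∀ t : ℝ, 0 < t → ∀ x : ℝ³, ‖u t x‖ ≤ C / (‖x‖ + Real.sqrt t)) := by
  obtain ⟨cstar, C, h1, h2, H⟩ := h γ Cstar hγ hγ1 hC
  refine ⟨cstar, max C 1, h1, h2, lt_max_of_lt_right one_pos, ?_⟩
  intro c u₀ hc hcle hloc hsup hhol hdiv hdss
  obtain ⟨u, p, hLL, hd, hI, -⟩ := H c u₀ hc hcle hloc hsup hhol hdiv hdss
  refine ⟨u, p, hLL, hd, fun t ht x => (hI t ht x).trans ?_⟩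
  have hden : 0 < ‖x‖ + Real.sqrt t := add_pos_of_nonneg_of_pos (norm_nonneg _) (Real.sqrt_pos.2 ht)
  exact div_le_div_of_nonneg_right (le_max_left _ _) hden.le

/-- The forward envelope `‖u(t,x)‖ ≤ C/(‖x‖ + √t)` of (1.12) is the time-reflection of the tree's backward
Type I envelope: `HasTypeIDecay C (fun t x => u (-t) x)` says exactly `‖u(−t)(x)‖ ≤ C/(‖x‖ + √(−t))` for `t < 0`,
i.e. the forward bound for `−t > 0` (definitional bookkeeping linking Tsai's class (1.12)₁ to `SelfSimilar.lean`).
[cite: Tsai2014, (1.12) (arXiv:1210.2783 p. 3)] -/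
theorem hasTypeIDecay_reflect_iff {C : ℝ} {u : ℝ → ℝ³ → ℝ³} :
    HasTypeIDecay C (fun t x => u (-t) x) ↔ ∀ t : ℝ, 0 < t → ∀ x : ℝ³, ‖u t x‖ ≤ C / (‖x‖ + Real.sqrt t) := by
  constructor
  · intro h t ht x
    have := h (-t) (by linarith) x
    simpa using this
  · intro h t ht x
    have := h (-t) (by linarith) x
    simpa using this

end Literature.Analysis.FluidPDE

end
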